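import Summits.BirchSwinnertonDyer.Rank1Residual.AdditivePotMult.HeegnerIndexRecordsIrreducible
import HarnessLib

/-!
# Rank ZERO, irreducible non-surjective image, `#Ш_an(E) = p²·unit`: the index-BOUND row predicate
# (`ord_p m = 1` on both engines) — per pair `BSD(E,p)` modulo ONE descent certificate `Ш(E)[p] ≠ 0`
# (cell `b2b-bsdres`, sub-cell additive-p1, gen 14)

HONEST FRAMING (run/shared/lean/b2b/bsd-rank1-residual/, verbatim): the goal of the cell is to
DELETE the COMBINATION-SHAPED residual classes for ALL analytic-rank `≤ 1` elliptic curves over `ℚ`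
— "full BSD formula for every rank `≤ 1` curve in class C" assembled STRICTLY from published
theorems — so that the rank-`≤ 1` remainder becomes exactly the CONSTRUCTION-SHAPED classes, which
are TYPED (missing-input `Prop`s), NOT attempted. This is not "finishing BSD". X3/X4 stay
CONSTRUCTION-SHAPED; nothing about elliptic curves is asserted here; NOTHING is booked.

WHAT THIS FILE DOES. The schema `RowZero` of `HeegnerIndexRecordsIrreducible.lean` (p247399) stores
a two-engine Heegner-index row of a RANK-ZERO curve at an additive odd `p` with irreducible
non-surjective mod-`p` image; its predicate `RowZero.consistent` is the EXACT-certificate shape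
(`ord_p m = 0`, `p ∤ #Ш_an(E)`), read by `ClassX4[M].bsdp_rankZero_of_indexCertificate[_of_odd]`
(p247133). Among the Tamagawa-free targets of the census (census-g13) 21 rows have `p² ∣ #Ш_an(E)`
(13 (G) and 2 (M) at `p = 3` with `#Ш_an = 9`, 6 (G) at `p = 5` with `#Ш_an = 25`); there the
Birch–Swinnerton-Dyer conjecture predicts `ord_p [E(K) : ℤ y_K] = 1` at EVERY Heegner field, so no
exact certificate can exist, and the per-pair lever of record is the index-BOUND reading
`ClassX4.bsdp_rankZero_of_indexBound_of_exists_torsion_of_odd` (p247133; Matar–Nekovář 2019 Thm. 0.3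
= tree fact A91 with `k = 1`: `ord_p [E(K):ℤP] ≤ 1` ⟹ `ord_p #Ш(E) ≤ 2`; lower half by Cassels–Tate
squareness from ONE nonzero `p`-torsion class in `Ш(E/ℚ)`; NO Tamagawa and NO Manin hypothesis in
that reading). This file adds the DATA predicate for such rows — `RowZero.consistentBound`: the same
field, twist, point and witness checks as `RowZero.consistent`, but `p² ∥ #Ш_an(E)` and the two
engines' agreement `m₁ = m₂`, `ord_p m₁ = ord_p m₂ = 1` (`p ∥ m₁`) — and `CheckedZeroBound` with its
decidability, so that the gen-14 index-bound rows (engine 1c = Heegner point of `E` over `K` at level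
`N_E`, REPORT §19.4; engine 2 stdlib) can be stored as kernel-rechecked evidence. READING per row
(modulo the referee's ruling and the ONE missing per-pair input, a descent certificate `Ш(E)[p] ≠ 0`
from the cell's descent engines — request R-addp1-g13/g14 to sha-2 / harvest-1 / n1011): with
`r_an(E) = 0` (Cremona), `ClassX4.bsdp_rankZero_of_indexBound_of_exists_torsion_of_odd` ⟹ `BSD(E,p)`.

References: Matar–Nekovář 2019 Thm. 0.3 [MatarNekovar2019]; Cassels 1962 / Silverman AEC X.4.14
[SilvermanAEC2009]; Miller 2011 (normalisation) [Miller2011LMS]; Cremona's tables [Cremona2006].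
-/

set_option autoImplicit false

namespace Summit.BirchSwinnertonDyer.Rank1Residual.AdditivePotMult.HeegnerIndexRecordsIrr

open Summit.BirchSwinnertonDyer.BirchSwinnertonDyer.Rank1Residual.HeegnerIndexRecords
  (vp bInv discr c4 isPrimeTD factorsOK weierstrassEvalZ)
open Summit.BirchSwinnertonDyer.Rank1Residual.AdditivePotMult.HeegnerIndexRecords (c6 isFundDiscNeg)

/-- The in-kernel recheck of a rank-zero index-BOUND row: as `RowZero.consistent` (`p` odd prime,
`p² ∣ N`, `Δ ≠ 0`, Frobenius irreducibility witness, `D < −4` fundamental with `p ∤ D`, `(D,N) = 1`,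
Heegner witness, `F` the `D`-twist with `N_F = N·D²`, the point ON `F` with a non-torsion witness,
`p ∤ #E(ℚ)_tors·∏c_ℓ(E)`, Manin `1` with optimality code `≥ 1`) EXCEPT that `#Ш_an(E)` is divisible by
`p²` and not by `p³`, and the engines agree on `m₁ = m₂` with `ord_p m₁ = ord_p m₂ = 1`
(`p ∣ m₁`, `p² ∤ m₁`). [folklore] -/
def RowZero.consistentBound (r : RowZero) : Bool :=
  isPrimeTD r.p && (r.p % 2 == 1) && (r.ainvs.length == 5) && (r.Fainvs.length == 5) &&
  factorsOK r.N r.Nfactors && (r.N % (r.p * r.p) == 0) && (discr r.ainvs != 0) &&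
  frobIrrWitness r.ainvs r.p r.irrWitness &&
  decide (r.D < -4) && (r.D % (r.p : ℤ) != 0) && (Int.gcd r.D r.N == 1) && isFundDiscNeg r.D r.Dfactors &&
  ((((r.hw : ℤ) ^ 2 - r.D) % (4 * (r.N : ℤ))) == 0) &&
  r.twistOK && (r.NF == r.N * r.D.natAbs * r.D.natAbs) &&
  decide (1 ≤ r.Pd) && (weierstrassEvalZ r.Fainvs r.PX r.PY r.Pd == 0) &&
  nonTorsionWitness r.Fainvs r.PX r.PY r.Pd &&
  (r.tors % r.p != 0) && (r.tam % r.p != 0) &&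
  (r.shaAn % (r.p * r.p) == 0) && (r.shaAn % (r.p * r.p * r.p) != 0) &&
  decide (1 ≤ r.optcode) && (r.manin == 1) &&
  (r.m1 == r.m2) && (r.v1 == 1) && (r.v2 == 1) && (r.m1 % r.p == 0) && (r.m1 % (r.p * r.p) != 0)

/-- A list of rank-zero index-bound rows is `CheckedZeroBound` when every row satisfies
`RowZero.consistentBound`. [folklore] -/
def CheckedZeroBound (rs : List RowZero) : Prop := rs.all RowZero.consistentBound = true

/-- `CheckedZeroBound rs` is decidable. [folklore] -/
instance CheckedZeroBound.instDecidable (rs : List RowZero) : Decidable (CheckedZeroBound rs) :=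
  inferInstanceAs (Decidable (rs.all RowZero.consistentBound = true))

/-- Unpacking `CheckedZeroBound`. [folklore] -/
theorem CheckedZeroBound.consistentBound_of_mem {rs : List RowZero} (h : CheckedZeroBound rs)
    {r : RowZero} (hr : r ∈ rs) : r.consistentBound = true :=
  List.all_eq_true.1 h r hr

/-- `CheckedZeroBound` of a concatenation splits. [folklore] -/
theorem CheckedZeroBound.append {rs rs' : List RowZero} (h : CheckedZeroBound rs)
    (h' : CheckedZeroBound rs') : CheckedZeroBound (rs ++ rs') := by
  unfold CheckedZeroBound at *
  rw [List.all_append, h, h', Bool.and_self]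

end Summit.BirchSwinnertonDyer.Rank1Residual.AdditivePotMult.HeegnerIndexRecordsIrr
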